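import Literature.NumberTheory.Automorphic.PairLFunctionPoles
import HarnessLib

/-!
# Arthur–Clozel (2.2) at `s = 1` for different ranks from its two printed halves

Topic `NumberTheory/Automorphic`; namespace `Literature.NumberTheory.Automorphic`. Proof file
(theorems only: no definition, no named fact, no instance) next to `PairLFunctionPoles`, which
vendors Arthur–Clozel, *Simple algebras, base change, and the advanced theory of the trace
formula*, Ann. of Math. Stud. 120 (1989), Ch. 3 §2, p. 171, (2.2)–(2.3) as named facts about the
partial Rankin–Selberg `L`-function `L^S(s, π ⊗ σ) = partialPairL S α β s` of the Satake families
`α`, `β` of unitary cuspidal `π` on `GL_n(𝔸_K)` and `σ` on `GL_m(𝔸_K)`.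

It records, as a proved reduction, the architecture of the named fact
`JacquetShalika1981_partialPairL_at_one_of_rank_ne` — (2.2) at `s₀ = 1` for `n ≠ m`: "`L^S` has a
finite **non-zero** limit as `s → 1`, `Re s > 1`" — along the attribution printed by Arthur–Clozel
(p. 171): "(cf. [27(b), Prop. 3.6]. The non-vanishing part of these results is due to Shahidi
[36(a)])", where `[27(b)]` = Jacquet–Shalika, *On Euler products and the classification of
automorphic forms II*, Amer. J. Math. 103 (1981), Prop. 3.6, and `[36(a)]` = Shahidi, *On
nonvanishing of `L`-functions*, Bull. Amer. Math. Soc. 2 (1980), 462–464 (Theorem, p. 462: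
"`L_S(1 + it, π × π') ≠ 0` for all `t ∈ ℝ`", for cuspidal `π` on `GL_n`, `π'` on `GL_m` and `S` the
ramified places together with the infinite ones). For `n ≠ m` the exceptional set
`X = {s : Re s = 1, π ⊗ | |^{s-1} ≅ σ̃}` of (2.2) is empty, and the printed sentence has two halves:

* (JS) "the function `L^S` extends continuously to the line `Re s = 1`": there is `g : ℂ → ℂ`
  continuous on the closed half-plane `{s | 1 ≤ re s}` and equal to `partialPairL S α β` on the open
  half-plane `{s | 1 < re s}` of absolute convergence ((2.1));
* (Sh) "Moreover, it does not vanish there": rendered junk-robustly on the tree's `partialPairL`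
  (a genuine value only where the Euler product converges, so that "`L^S(1 + it)`" is a boundary
  value from `Re s > 1`): every limit `c` of `partialPairL S α β s` as `s → 1 + it`, `Re s > 1`, is
  non-zero.

Both halves are **theories** that neither Mathlib nor `Literature/` has at the pin — (JS) is the
global Rankin–Selberg method for `GL_n × GL_m`, `m < n` (entire global integrals
`∫ ℙφ (h 0; 0 1) φ'(h) |det h|^{s-1/2} dh`, their Euler factorisation through the uniqueness of
Whittaker models, the unramified computation `Ψ_v = det(1 - t_{π,v} ⊗ t_{σ,v} q_v^{-s})⁻¹`, trivial
ramified finite integrals, archimedean integrals continuous on `Re s ≥ 1` with a non-vanishing choice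
at each point; Jacquet–Shalika II, §3; Cogdell, *Analytic theory of `L`-functions for `GL_n`*, in
Gelbart–de Shalit (eds.), Thms. 2.1, 4.1, 4.2), and (Sh) is Langlands' theory of Eisenstein series on
`GL_{n+m}` induced from `π̃ ⊗ σ` on the Levi `GL_n × GL_m` (meromorphic continuation, holomorphy on
the unitary axis) together with the Casselman–Shalika formula for the Whittaker coefficient
(Shahidi, loc. cit., outline of proof). By the fact-decomposition discipline (D-0026) they are
therefore **not** vendored here as further named facts; they enter the theorems below as explicit
hypotheses, spelled out in full, so that the reduction is on record and ready for whichever half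
lands first:

* `tendsto_nhdsWithin_one_lt_re_of_continuousOn_extension` (**proved**): a continuous extension
  `g` to `{1 ≤ re s}` of a function `L` on `{1 < re s}` computes every boundary limit:
  `L(s) → g(s₀)` as `s → s₀`, `Re s > 1`, for `Re s₀ ≥ 1` — the dictionary between "extends
  continuously to the line" and the `Tendsto (⋯) (𝓝[{s | 1 < re s}] s₀)` rendering of
  `PairLFunctionPoles`;
* `exists_ne_zero_and_tendsto_of_continuousOn_extension` (**proved**): (JS)-shape + (Sh)-shape
  hypotheses on any `L : ℂ → ℂ` give a finite non-zero boundary limit at every `1 + it`;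
* `JacquetShalika1981_partialPairL_at_one_of_rank_ne_of_halves` (**proved**): the two printed
  halves, as hypotheses quantified exactly like the named fact, imply
  `JacquetShalika1981_partialPairL_at_one_of_rank_ne` (`t = 0`), and
  `exists_ne_zero_tendsto_partialPairL_line_of_halves` gives the whole line `Re s = 1` for `n ≠ m`
  (the `n ≠ m` part of `JacquetShalika1981_partialPairL_boundary_of_ne_one` as well).

## References

* J. Arthur, L. Clozel, *Simple algebras, base change, and the advanced theory of the trace
  formula*, Ann. of Math. Stud. 120 (1989), Ch. 3 §2, (2.1)–(2.3), p. 171. [ArthurClozelAMS120]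
* H. Jacquet, J. A. Shalika, *On Euler products and the classification of automorphic forms II*,
  Amer. J. Math. 103 (1981), 777–815, Prop. 3.6. [JacquetShalikaAJM1981II]
* F. Shahidi, *On nonvanishing of `L`-functions*, Bull. Amer. Math. Soc. (N.S.) 2 (1980), 462–464,
  Theorem (p. 462). [ShahidiBAMS1980]
* F. Shahidi, *On certain `L`-functions*, Amer. J. Math. 103 (1981), 297–355. [ShahidiAJM1981]
* J. W. Cogdell, *Analytic theory of `L`-functions for `GL_n`*, in: An Introduction to the Langlands
  Program (J. Bernstein, S. Gelbart, eds.), Birkhäuser (2003), §§2–4.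
-/

noncomputable section

open scoped MatrixGroups Topology
open NumberField IsDedekindDomain MeasureTheory Filter Complex

namespace Literature.NumberTheory.Automorphic

open AdelicGroupData

/-! ### Boundary limits from a continuous extension -/

/-- The open half-plane `{s | 1 < re s}` lies in the closed half-plane `{s | 1 ≤ re s}`. [folklore] -/
theorem setOf_one_lt_re_subset_setOf_one_le_re :
    {s : ℂ | 1 < s.re} ⊆ {s : ℂ | 1 ≤ s.re} :=
  fun s (hs : 1 < s.re) => show 1 ≤ s.re from le_of_lt hs

/-- `1 + it` lies in the closed half-plane `{s | 1 ≤ re s}` (on its boundary line). [folklore] -/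
theorem one_add_mul_I_mem_setOf_one_le_re (t : ℝ) :
    (1 + t * I : ℂ) ∈ {s : ℂ | 1 ≤ s.re} := by
  simp

/-- **A continuous extension computes boundary limits.** If `g` is continuous on the closed
half-plane `{s | 1 ≤ re s}` and agrees with `L` on the open half-plane `{s | 1 < re s}`, then at every
point `s₀` of the closed half-plane `L(s) → g(s₀)` as `s → s₀` with `Re s > 1` (restrict the
continuity of `g` within the closed half-plane to the smaller open one, on which `g = L`). This is
the dictionary between "`L^S` extends continuously to the line `Re s = 1`" (Arthur–Clozel, Ch. 3,
(2.2)) and the `Tendsto (⋯) (𝓝[{s | 1 < re s}] s₀)` rendering of `PairLFunctionPoles`. [folklore] -/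
theorem tendsto_nhdsWithin_one_lt_re_of_continuousOn_extension {g L : ℂ → ℂ}
    (hg : ContinuousOn g {s : ℂ | 1 ≤ s.re}) (hgL : Set.EqOn g L {s : ℂ | 1 < s.re}) {s₀ : ℂ}
    (hs₀ : s₀ ∈ {s : ℂ | 1 ≤ s.re}) :
    Tendsto L (𝓝[{s : ℂ | 1 < s.re}] s₀) (𝓝 (g s₀)) := by
  have h1 : Tendsto g (𝓝[{s : ℂ | 1 < s.re}] s₀) (𝓝 (g s₀)) :=
    (hg s₀ hs₀).tendsto.mono_left (nhdsWithin_mono _ setOf_one_lt_re_subset_setOf_one_le_re)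
  exact h1.congr' (eventually_nhdsWithin_of_forall fun s hs => hgL hs)

/-- **The two halves of Arthur–Clozel (2.2) give a finite non-zero boundary limit** (pure
bookkeeping, for any function `L` on the half-plane): if `L` has a continuous extension `g` to
`{s | 1 ≤ re s}` ("`L^S` extends continuously to the line `Re s = 1`") and every boundary limit of
`L` at `1 + it` from `Re s > 1` is non-zero ("moreover, it does not vanish there", in the junk-robust
limit form), then `L` has a finite non-zero limit at `1 + it` from `Re s > 1`, namely `g (1 + it)`.
[folklore] -/
theorem exists_ne_zero_and_tendsto_of_continuousOn_extension {g L : ℂ → ℂ}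
    (hg : ContinuousOn g {s : ℂ | 1 ≤ s.re}) (hgL : Set.EqOn g L {s : ℂ | 1 < s.re}) (t : ℝ)
    (hne : ∀ {c : ℂ}, Tendsto L (𝓝[{s : ℂ | 1 < s.re}] (1 + t * I)) (𝓝 c) → c ≠ 0) :
    ∃ c : ℂ, c ≠ 0 ∧ Tendsto L (𝓝[{s : ℂ | 1 < s.re}] (1 + t * I)) (𝓝 c) :=
  have hlim := tendsto_nhdsWithin_one_lt_re_of_continuousOn_extension hg hgL
    (one_add_mul_I_mem_setOf_one_le_re t)
  ⟨g (1 + t * I), hne hlim, hlim⟩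

/-! ### (2.2) for `n ≠ m` from the Jacquet–Shalika and Shahidi halves -/

section Halves

variable {n m : ℕ} {K : Type} [Field K] [NumberField K]
  {μ : Measure (gl n K).automorphicQuotient} [(gl n K).IsAutomorphicMeasure μ]
  {μ' : Measure (gl m K).automorphicQuotient} [(gl m K).IsAutomorphicMeasure μ']

/-- **Arthur–Clozel (2.2) on the whole line `Re s = 1` for `n ≠ m`, from its two printed halves.**
Hypotheses, quantified exactly like the named facts of `PairLFunctionPoles` (unitary cuspidal `π` on
`GL_n(𝔸_K)`, `σ` on `GL_m(𝔸_K)`, `n ≠ m`, `n, m ≥ 1`, a finite set `S` of finite places and Satake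
families `α`, `β` of `π`, `σ` off `S`):
* `hJS` — the Jacquet–Shalika half of (2.2) ("the function `L^S` extends continuously to the line
  `Re s = 1` with `X` removed", `X = ∅` for `n ≠ m`; Jacquet–Shalika II, Prop. 3.6): some `g`
  continuous on `{s | 1 ≤ re s}` equals `partialPairL S α β` on `{s | 1 < re s}`;
* `hSh` — Shahidi's half ("Moreover, it does not vanish there"; Shahidi (1980), Theorem p. 462:
  `L_S(1 + it, π × π') ≠ 0` for all real `t`), in boundary-value form: every limit of
  `partialPairL S α β` at `1 + it` from `Re s > 1` is non-zero.
Conclusion: at every `s₀ = 1 + it`, `L^S(s, π ⊗ σ)` has a finite non-zero limit as `s → s₀`,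
`Re s > 1`. Neither hypothesis is in the tree yet (both are theories: the global Rankin–Selberg
method for `GL_n × GL_m`, resp. Eisenstein series on `GL_{n+m}`; module docstring), so this is the
proved *reduction* of (2.2), `n ≠ m`, to them. [cite: ArthurClozelAMS120, Ch. 3 §2 (2.2)] -/
theorem exists_ne_zero_tendsto_partialPairL_line_of_halves
    (hJS : ∀ (_hnm : n ≠ m) (_hn : 0 < n) (_hm : 0 < m) (P : CuspidalAutomorphicRepGL n K μ)
      (P' : CuspidalAutomorphicRepGL m K μ') {S : Set (HeightOneSpectrum (𝓞 K))} (_hS : S.Finite)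
      {α β : SatakeFamily K} (_hα : IsSatakeFamilyOf P S α) (_hβ : IsSatakeFamilyOf P' S β),
      ∃ g : ℂ → ℂ, ContinuousOn g {s : ℂ | 1 ≤ s.re} ∧
        Set.EqOn g (partialPairL S α β) {s : ℂ | 1 < s.re})
    (hSh : ∀ (_hnm : n ≠ m) (_hn : 0 < n) (_hm : 0 < m) (P : CuspidalAutomorphicRepGL n K μ)
      (P' : CuspidalAutomorphicRepGL m K μ') {S : Set (HeightOneSpectrum (𝓞 K))} (_hS : S.Finite)
      {α β : SatakeFamily K} (_hα : IsSatakeFamilyOf P S α) (_hβ : IsSatakeFamilyOf P' S β)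
      (t : ℝ) {c : ℂ}
      (_hc : Tendsto (partialPairL S α β) (𝓝[{s : ℂ | 1 < s.re}] (1 + t * I)) (𝓝 c)), c ≠ 0)
    (hnm : n ≠ m) (hn : 0 < n) (hm : 0 < m) (P : CuspidalAutomorphicRepGL n K μ)
    (P' : CuspidalAutomorphicRepGL m K μ') {S : Set (HeightOneSpectrum (𝓞 K))} (hS : S.Finite)
    {α β : SatakeFamily K} (hα : IsSatakeFamilyOf P S α) (hβ : IsSatakeFamilyOf P' S β) (t : ℝ) :
    ∃ c : ℂ, c ≠ 0 ∧
      Tendsto (partialPairL S α β) (𝓝[{s : ℂ | 1 < s.re}] (1 + t * I)) (𝓝 c) := by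
  obtain ⟨g, hg, hgL⟩ := hJS hnm hn hm P P' hS hα hβ
  exact exists_ne_zero_and_tendsto_of_continuousOn_extension hg hgL t
    (fun hc => hSh hnm hn hm P P' hS hα hβ t hc)

/-- **`JacquetShalika1981_partialPairL_at_one_of_rank_ne` from its two printed halves** (proved
reduction; Arthur–Clozel, Ch. 3, (2.2) at `s₀ = 1`, `n ≠ m`: "cf. [27(b), Prop. 3.6]. The
non-vanishing part of these results is due to Shahidi [36(a)]"). With `hJS` (Jacquet–Shalika II,
Prop. 3.6: continuous extension of `L^S(s, π ⊗ σ)` to `Re s ≥ 1`, `n ≠ m`) and `hSh` (Shahidi (1980),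
Theorem p. 462: non-vanishing of the boundary values on `Re s = 1`) as in
`exists_ne_zero_tendsto_partialPairL_line_of_halves`, the named fact follows as its case `t = 0`
(`1 + 0·i = 1`): `L^S(s, π ⊗ σ)` has a finite non-zero limit as `s → 1`, `Re s > 1`. The two
hypotheses are exactly what remains to be built for an unconditional
`JacquetShalika1981_partialPairL_at_one_of_rank_ne_holds`. [cite: ArthurClozelAMS120, Ch. 3 §2 (2.2)] -/
theorem JacquetShalika1981_partialPairL_at_one_of_rank_ne_of_halves
    (hJS : ∀ (_hnm : n ≠ m) (_hn : 0 < n) (_hm : 0 < m) (P : CuspidalAutomorphicRepGL n K μ)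
      (P' : CuspidalAutomorphicRepGL m K μ') {S : Set (HeightOneSpectrum (𝓞 K))} (_hS : S.Finite)
      {α β : SatakeFamily K} (_hα : IsSatakeFamilyOf P S α) (_hβ : IsSatakeFamilyOf P' S β),
      ∃ g : ℂ → ℂ, ContinuousOn g {s : ℂ | 1 ≤ s.re} ∧
        Set.EqOn g (partialPairL S α β) {s : ℂ | 1 < s.re})
    (hSh : ∀ (_hnm : n ≠ m) (_hn : 0 < n) (_hm : 0 < m) (P : CuspidalAutomorphicRepGL n K μ)
      (P' : CuspidalAutomorphicRepGL m K μ') {S : Set (HeightOneSpectrum (𝓞 K))} (_hS : S.Finite)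
      {α β : SatakeFamily K} (_hα : IsSatakeFamilyOf P S α) (_hβ : IsSatakeFamilyOf P' S β)
      (t : ℝ) {c : ℂ}
      (_hc : Tendsto (partialPairL S α β) (𝓝[{s : ℂ | 1 < s.re}] (1 + t * I)) (𝓝 c)), c ≠ 0) :
    JacquetShalika1981_partialPairL_at_one_of_rank_ne (n := n) (m := m) (K := K) (μ := μ)
      (μ' := μ') := by
  intro hnm hn hm P P' S hS α β hα hβ
  have h := exists_ne_zero_tendsto_partialPairL_line_of_halves hJS hSh hnm hn hm P P' hS hα hβ 0
  simpa using h

end Halves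

end Literature.NumberTheory.Automorphic
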